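import Summits.BirchSwinnertonDyer.BirchSwinnertonDyer.Theorems.BiquadraticEisensteinDescentHeegnerTwistCouplingInSupplyKrizLiGrossCornerII
import Summits.BirchSwinnertonDyer.BirchSwinnertonDyer.Theorems.PrintCFramBottomClassIndexLawFiveLeKrizLiBindersAnchor19
import Summits.BirchSwinnertonDyer.BirchSwinnertonDyer.Theorems.PrintCFramBottomClassIndexLawFiveLeKrizLiBindersAnchor43
import Summits.BirchSwinnertonDyer.BirchSwinnertonDyer.Theorems.PrintCFramBottomClassIndexLawFiveLeKrizLiBindersAnchor67
import Summits.BirchSwinnertonDyer.BirchSwinnertonDyer.Theorems.PrintCFramBottomClassIndexLawFiveLeKrizLiBindersAnchor163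
import Summits.BirchSwinnertonDyer.BirchSwinnertonDyer.Theorems.PrintCFramBottomClassIndexLawFiveLeKrizLi4CertKit
import Summits.BirchSwinnertonDyer.BirchSwinnertonDyer.Theorems.PrintCFramBottomClassIndexLawFiveLeKrizLi4HeegnerHypothesis
import Mathlib.Tactic.NormNum.LegendreSymbol
import HarnessLib

set_option linter.dupNamespace false -- `Summit.BirchSwinnertonDyer.BirchSwinnertonDyer.Theorems.…` (summit = sub, D-0017)
set_option autoImplicit false

/-!
# Crux `HeegnerTwistCouplingInSupply` (stmt-BirchSwinnertonDyer-21381) — the GROSS-CURVE Kriz–Li corners, part V: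
# a second row on `ℚ(√−19)` BEYOND cell cfram's window — `A(19)^{(41)}` at the inert crux prime `41`, `K'' = ℚ(√−31)`, with its certificates

Route `BiquadraticEisensteinDescent` (cell `pub/bsd-wall`, width seat `bsd-wall-cm-bed-w4` g28; `--supports` 21381, helper). As part IV, on the CM
field `ℚ(√−19)` (cfram's window holds `A(19)^{(e)}` for `e ≤ 37`): the class `A19e41 = A(19)^{(41)}` (`41 ≡ 3 (mod 19)` is a non-residue: `41` is INERT
in `ℚ(√−19)`; `e = 41 ≡ 1 (mod 4)`), Kriz–Li at `p_KL = 19` (`k = 5`, tables `KrizLiBinders.teichmullerPowTable_19_13/_19_4`, trace form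
`EisensteinTraceForm.lFunction_cm19_mod` `a_ℓ ≡ ℓ⁵ + ℓ¹⁴`), census-style Heegner field `K'' = ℚ(√−31)` (`h = 3 < 41`; the first prime discriminant passing the
splitting conditions and the `K''`-certificate in the generator's order): kernel certificates `certSum1/2_A19e41` (`19 ∥ S`, three `decide +kernel` blocks), unit theorems,
character block, Heegner hypothesis, and ★ `cruxConclusion_A19e41` — the CONCLUSION of crux 21381 at `(W, 41)` for every globally minimal
`W ∼ A(19)^{(41)}` with `r_an(W) ≠ 0`, modulo `hKL`, `hGZ`, `hHP` ONLY.

HONEST FRAMING: one more isogeny class; the crux (all CM `W`, all `p`), C⁺, its registered stubs and BSD are NOT proved. THEOREMS ONLY.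
Supports stmt-BirchSwinnertonDyer-21381. [cite: KrizLi2019, Thm. 1.20 (pp. 7–8), §1.5 (1), Rem. 1.21] [cite: Washington1997, §5.1, Thm. 4.2]
[cite: GrossLMS1991, §1] [cite: Cox2013, §1.C Lemma 1.14, §2.A Thm. 2.13]
-/

noncomputable section

open scoped Classical NumberTheorySymbols

namespace Summit.BirchSwinnertonDyer.BirchSwinnertonDyer.Theorems.KrizLiGrossCorner

open _root_.WeierstrassCurve NumberField DirichletCharacter
open Literature.NumberTheory.EllipticCurves Literature.NumberTheory.EllipticCurves.KrizLi2019 Literature.NumberTheory.LFunctions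
  Literature.NumberTheory.EllipticCurves.ModularForms Literature.NumberTheory.EllipticCurves.Rank1Residual
  Literature.NumberTheory.QuadraticFields Literature.NumberTheory.QuadraticFields.Quadratic
  Summit.BirchSwinnertonDyer.Rank1Residual Summit.BirchSwinnertonDyer.Rank1Residual.X12.O11
  Summit.BirchSwinnertonDyer.Rank1Residual.X12.O11.RouteU
  Summit.BirchSwinnertonDyer.BirchSwinnertonDyer.Theorems.PrintCFram
  Summit.BirchSwinnertonDyer.BirchSwinnertonDyer.Theorems.PrintCFram.KrizLiBindersTwisted

/-! ## Class `A19e41` = `A(19)^{(41)}` : `ψ = χ_{41}·ω^{5}` (odd twisting discriminant), `K'' = ℚ(√-31)`, crux prime `p = 41` -/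

set_option maxRecDepth 400000 in
/-- Certificate sum for `θ₁` of `A19e41`: `S = Σ_{j<779} χ(j)·t(j mod 19)·j = 971413` (`19 ∥ S`), Jacobi symbols by Euler's criterion in `ℕ`,
`decide +kernel`. [cite: KrizLi2019, §1.5 display (1) (p. 7)] -/
theorem certSum1_A19e41 :
    ∑ j ∈ Finset.range (19 * 41), (J((j : ℤ) | 41) * ((([0, 1, 307, 299, 28, 245, 99, 292, 293, 234, 127, 68, 69, 262, 116, 333, 62, 54, 360] : List ℕ).getD (j % 19) 0 : ℕ) : ℤ)) * (j : ℤ) ^ (0 + 1) = 971413 := by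
  simp_rw [RouteU.jacobiSym_prime_eq_ite_nat 41 (by norm_num) (by norm_num)]
  decide +kernel

/-- **`‖B_{1,θ₁}‖_{19} = 1` for the class `A19e41`** (`A(19)^{(41)}`): for every Teichmüller `ω` mod `19` and every `ℚ_19`-valued `θ₁`
mod `19·41` with values `χ_{41}(j)·ω(j)^{13}` (`= ψ⁻¹`, `ψ = χ_{41}·ω^{5}`), `B_{1,θ₁}` is a `19`-adic unit — the CLASS FACTOR of
Kriz–Li's (4). Witness of `θ ≠ 1`: `θ(58) = −1`. [cite: KrizLi2019, Thm. 1.20 (p. 8, hypothesis (4)) and §1.5 (1) (p. 7)]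
[cite: Washington1997, §5.1 and Thm. 4.2] -/
theorem norm_generalizedBernoulli_theta1_A19e41 [Fact (Nat.Prime 19)] (ω : DirichletCharacter ℚ_[19] 19)
    (hω : IsTeichmullerCharacter ω) (θ : DirichletCharacter ℚ_[19] (19 * 41))
    (hθ : ∀ j : ZMod (19 * 41), θ j = (J((j.val : ℤ) | 41) : ℚ_[19]) * ω (j.val : ZMod 19) ^ 13) :
    ‖generalizedBernoulli 1 θ‖ = 1 :=
  @KrizLi4Cert.norm_generalizedBernoulli_eq_one_of_table 19 41 _ ⟨by norm_num⟩ ω hω 13 (by norm_num)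
    (KrizLi4Cert.padicValNat_mul_eq_one (by norm_num)) (fun a => J((a : ℤ) | 41)) θ
    (fun j => by rw [hθ j]) 58 (by norm_num) (by norm_num) (by norm_num) (by norm_num)
    (fun j => ([0, 1, 307, 299, 28, 245, 99, 292, 293, 234, 127, 68, 69, 262, 116, 333, 62, 54, 360] : List ℕ).getD j 0) rfl KrizLiBinders.teichmullerPowTable_19_13 (971413) certSum1_A19e41
    (by norm_num) (by norm_num)

set_option maxRecDepth 400000 in
/-- Block 0 (`0 ≤ j < 10000`) of the certificate sum for `θ₂` of `A19e41` (`decide +kernel`). [cite: KrizLi2019, §1.5 display (1) (p. 7)] -/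
theorem certSum2_A19e41_block0 :
    ∑ j ∈ Finset.Ico (0 : ℕ) 10000, (J((j : ℤ) | 41) * J((j : ℤ) | 31) * ((([0, 1, 54, 62, 28, 245, 99, 292, 68, 234, 234, 68, 292, 99, 245, 28, 62, 54, 1] : List ℕ).getD (j % 19) 0 : ℕ) : ℤ)) * (j : ℤ) ^ (0 + 1) = -4455679 := by
  simp_rw [RouteU.jacobiSym_prime_eq_ite_nat 41 (by norm_num) (by norm_num), RouteU.jacobiSym_prime_eq_ite_nat 31 (by norm_num) (by norm_num)]
  decide +kernel

set_option maxRecDepth 400000 in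
/-- Block 1 (`10000 ≤ j < 20000`) of the certificate sum for `θ₂` of `A19e41` (`decide +kernel`). [cite: KrizLi2019, §1.5 display (1) (p. 7)] -/
theorem certSum2_A19e41_block1 :
    ∑ j ∈ Finset.Ico (10000 : ℕ) 20000, (J((j : ℤ) | 41) * J((j : ℤ) | 31) * ((([0, 1, 54, 62, 28, 245, 99, 292, 68, 234, 234, 68, 292, 99, 245, 28, 62, 54, 1] : List ℕ).getD (j % 19) 0 : ℕ) : ℤ)) * (j : ℤ) ^ (0 + 1) = -83623844 := by
  simp_rw [RouteU.jacobiSym_prime_eq_ite_nat 41 (by norm_num) (by norm_num), RouteU.jacobiSym_prime_eq_ite_nat 31 (by norm_num) (by norm_num)]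
  decide +kernel

set_option maxRecDepth 400000 in
/-- Block 2 (`20000 ≤ j < 24149`) of the certificate sum for `θ₂` of `A19e41` (`decide +kernel`). [cite: KrizLi2019, §1.5 display (1) (p. 7)] -/
theorem certSum2_A19e41_block2 :
    ∑ j ∈ Finset.Ico (20000 : ℕ) (19 * 1271), (J((j : ℤ) | 41) * J((j : ℤ) | 31) * ((([0, 1, 54, 62, 28, 245, 99, 292, 68, 234, 234, 68, 292, 99, 245, 28, 62, 54, 1] : List ℕ).getD (j % 19) 0 : ℕ) : ℤ)) * (j : ℤ) ^ (0 + 1) = -232957283 := by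
  simp_rw [RouteU.jacobiSym_prime_eq_ite_nat 41 (by norm_num) (by norm_num), RouteU.jacobiSym_prime_eq_ite_nat 31 (by norm_num) (by norm_num)]
  decide +kernel

/-- The certificate sum for `θ₂` of `A19e41` assembled from its 3 block(s): `S = Σ_{j<24149} χ(j)·t(j mod 19)·j = -321036806` (`19 ∥ S`).
[cite: KrizLi2019, §1.5 display (1) (p. 7)] -/
theorem certSum2_A19e41 :
    ∑ j ∈ Finset.range (19 * 1271), (J((j : ℤ) | 41) * J((j : ℤ) | 31) * ((([0, 1, 54, 62, 28, 245, 99, 292, 68, 234, 234, 68, 292, 99, 245, 28, 62, 54, 1] : List ℕ).getD (j % 19) 0 : ℕ) : ℤ)) * (j : ℤ) ^ (0 + 1) = -321036806 := by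
  rw [Finset.range_eq_Ico,
    ← Finset.sum_Ico_consecutive _ (show 0 ≤ 10000 by norm_num) (show 10000 ≤ 19 * 1271 by norm_num),
    ← Finset.sum_Ico_consecutive _ (show 10000 ≤ 20000 by norm_num) (show 20000 ≤ 19 * 1271 by norm_num),
    certSum2_A19e41_block0, certSum2_A19e41_block1, certSum2_A19e41_block2]
  norm_num

/-- **`‖B_{1,θ₂}‖_{19} = 1` for the class `A19e41` over `K'' = ℚ(√-31)`**: for every Teichmüller `ω` mod `19` and every `ℚ_19`-valued `θ₂`
mod `19·1271` with values `χ_{41}(j)·(j/31)·ω(j)^{4}` (`= ψ·ε_K·ω⁻¹`), `B_{1,θ₂}` is a `19`-adic unit — the `K''`-FACTOR of Kriz–Li's (4).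
Witness of `θ ≠ 1`: `θ(77) = −1`. [cite: KrizLi2019, Thm. 1.20 (p. 8, hypothesis (4)) and §1.5 (1) (p. 7)] [cite: Washington1997, §5.1 and Thm. 4.2] -/
theorem norm_generalizedBernoulli_theta2_A19e41 [Fact (Nat.Prime 19)] (ω : DirichletCharacter ℚ_[19] 19)
    (hω : IsTeichmullerCharacter ω) (θ : DirichletCharacter ℚ_[19] (19 * 1271))
    (hθ : ∀ j : ZMod (19 * 1271), θ j = (J((j.val : ℤ) | 41) : ℚ_[19]) * (J((j.val : ℤ) | 31) : ℚ_[19]) * ω (j.val : ZMod 19) ^ 4) :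
    ‖generalizedBernoulli 1 θ‖ = 1 :=
  @KrizLi4Cert.norm_generalizedBernoulli_eq_one_of_table 19 1271 _ ⟨by norm_num⟩ ω hω 4 (by norm_num)
    (KrizLi4Cert.padicValNat_mul_eq_one (by norm_num)) (fun a => J((a : ℤ) | 41) * J((a : ℤ) | 31)) θ
    (fun j => by rw [hθ j]; push_cast; ring) 77 (by norm_num) (by norm_num) (by norm_num) (by norm_num)
    (fun j => ([0, 1, 54, 62, 28, 245, 99, 292, 68, 234, 234, 68, 292, 99, 245, 28, 62, 54, 1] : List ℕ).getD j 0) rfl KrizLiBinders.teichmullerPowTable_19_4 (-321036806) certSum2_A19e41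
    (by norm_num) (by norm_num)

/-- **`A19e41 = A(19)^{(41)}` lies ON the Kriz–Li locus at `p_KL = 19` BY NAME over every quadratic `K''` of discriminant `-31`**: the
character ∧ `ε_K` ∧ Bernoulli block (`ψ = χ_{41}·ω^{5}`; cfram's engine `krizLi_characterBernoulliBlock_twist_odd` fed with the trace
form `a_ℓ(A(19)) ≡ ℓ^{5} + ℓ^{14}` and the two certificates above). [cite: KrizLi2019, Thm. 1.20 (pp. 7–8), Rem. 1.21, §2 (p. 12)]
[cite: Cox2013, §1.C Lemma 1.14] -/
theorem exists_krizLiCharacterBlock_A19e41 [Fact (Nat.Prime 19)] (W W₁ : WeierstrassCurve ℚ) [W.IsElliptic] [W₁.IsElliptic]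
    (hiso : IsIsogenous W W₁) (hW₁ : ∃ C : VariableChange ℚ, C • W₁ = cm19.quadraticTwist ((41 : ℤ) : ℚ))
    (K : Type) [Field K] [NumberField K] (hK2 : Module.finrank ℚ K = 2)
    (hdK : NumberField.discr K = -31) [NeZero (NumberField.discr K).natAbs] :
    ∃ (f : ℕ) (_ : NeZero f) (ψ : DirichletCharacter ℚ_[19] f) (ω : DirichletCharacter ℚ_[19] 19)
      (εK : DirichletCharacter ℚ_[19] (NumberField.discr K).natAbs),
      ψ.IsPrimitive ∧ IsTeichmullerCharacter ω ∧
      (∀ ℓ : ℕ, ℓ.Prime → ¬ (ℓ ∣ 19 * W.conductorNorm ℤ) →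
        ‖((W.LFunction ℓ : ℤ) : ℚ_[19]) - (ψ (ℓ : ZMod f) + ψ⁻¹ (ℓ : ZMod f) * ω (ℓ : ZMod 19))‖ < 1) ∧
      (ψ ((19 : ℕ) : ZMod f) ≠ 1 ∧ primVal (invMulOmega ψ ω) 19 ≠ 1) ∧
      (∀ ℓ : ℕ, (hℓ : ℓ.Prime) → ℓ ≠ 19 →
        (haveI := Fact.mk hℓ; ¬ W.HasGoodReductionAtPrime ℓ ∧ ¬ W.HasMultiplicativeReductionAtPrime ℓ) →
        ψ (ℓ : ZMod f) ≠ 1 ∧ primVal (invMulOmega ψ ω) ℓ ≠ 1) ∧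
      IsKroneckerCharacterOf K εK ∧
      ¬ (‖bernoulliOnePrim (bernoulliCharOne ψ εK) * bernoulliOnePrim (bernoulliCharTwo ψ εK ω)‖ ≤ ((19 : ℕ) : ℝ)⁻¹) ∧
      ψ.Odd := by
  haveI : Fact (Nat.Prime 31) := ⟨by norm_num⟩
  obtain ⟨ω, hω⟩ := exists_isTeichmullerCharacter (p := 19)
  obtain ⟨εK, hεK, hεKval⟩ := KrizLiBinders.exists_isKroneckerCharacterOf_of_discr (p := 19) hK2
    (Nat.Prime.prime (by norm_num : Nat.Prime 31)).squarefree (Or.inr ⟨hdK, by norm_num⟩)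
  have hd : (NumberField.discr K).natAbs = 31 := by rw [hdK]; rfl
  haveI : NeZero ((41 : ℤ)).natAbs := ⟨by decide⟩
  obtain ⟨χ, hχ⟩ := KrizLiBinders.exists_jacobiCharPadic (p := 19) ((41 : ℤ)).natAbs
  have hpar : χ (-1) * (-1) ^ 5 = -1 := by
    have e : ((40 : ℕ) : ZMod ((41 : ℤ)).natAbs) = -1 := by decide
    rw [← e, hχ 40]; norm_num
  obtain ⟨f, hf, ψ, hprim, hodd, hss, h1, h3, h4⟩ :=
    krizLi_characterBernoulliBlock_twist_odd (p := 19) (by norm_num) cm19 (k := 5) (by norm_num) (by norm_num)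
      (fun r _ hr => EisensteinTraceForm.hasGoodReductionAtPrime_cm19 r hr)
      (fun ℓ _ hℓ => by simpa using EisensteinTraceForm.lFunction_cm19_mod ℓ hℓ) W W₁ hiso (e := 41) (by norm_num)
      (by rw [← Int.squarefree_natAbs]; exact (Nat.Prime.prime (by norm_num : Nat.Prime 41)).squarefree) (by norm_num) hW₁ χ hχ hpar ω hω
      (q := 31) (by norm_num) (by norm_num) (by norm_num) hd εK hεKval
      (fun θ₁ hθ₁ => norm_generalizedBernoulli_theta1_A19e41 ω hω θ₁ hθ₁)
      (fun θ₂ hθ₂ => norm_generalizedBernoulli_theta2_A19e41 ω hω θ₂ (fun j => by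
        have h : θ₂ j = (J((j.val : ℤ) | 41 * 31) : ℚ_[19]) * ω (j.val : ZMod 19) ^ 4 := hθ₂ j
        refine h.trans ?_
        rw [RouteU.jacobiSym_mul_right' _ (by norm_num) (by norm_num)]; push_cast; ring))
  exact ⟨f, hf, ψ, ω, εK, hprim, hω, hss, h1, h3, hεK, by exact_mod_cast h4, hodd⟩

/-- **Heegner hypothesis for `A19e41` (`A(19)^{(41)}`) over every quadratic `K''` with `d_{K''} = -31`**: the primes of `N_W` lie in
{`19`, `41`} and both split in `K''`. [cite: GrossLMS1991, §1 (p. 235)] [cite: Cox2013, §1.C (1.18)] -/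
theorem satisfiesHeegnerHypothesis_A19e41 [Fact (Nat.Prime 19)] (W W₁ : WeierstrassCurve ℚ) [W.IsElliptic] [W₁.IsElliptic]
    (hiso : IsIsogenous W W₁) (hW₁ : ∃ C : VariableChange ℚ, C • W₁ = cm19.quadraticTwist ((41 : ℤ) : ℚ))
    (K : Type) [Field K] [NumberField K] (hK2 : Module.finrank ℚ K = 2) (hdK : NumberField.discr K = -31) :
    SatisfiesHeegnerHypothesis (W.conductorNorm ℤ) K := by
  refine satisfiesHeegnerHypothesis_of_twist_emod_four cm19 (fun r _ hr => EisensteinTraceForm.hasGoodReductionAtPrime_cm19 r hr)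
    W W₁ hiso (e := 41) (by norm_num) hW₁ K (fun ℓ hℓ h => ?_)
  have hcases : ℓ = 19 ∨ ℓ = 41 := by
    rcases h with h | hd
    · exact Or.inl h
    · exact Or.inr ((Nat.prime_dvd_prime_iff_eq hℓ (by norm_num : Nat.Prime 41)).mp (by exact_mod_cast hd))
  rcases hcases with rfl | rfl
  · rw [Quadratic.ncard_primesOver_eq_two_iff_jacobiSym hK2 (by norm_num) (by norm_num), hdK]; norm_num
  · rw [Quadratic.ncard_primesOver_eq_two_iff_jacobiSym hK2 (by norm_num) (by norm_num), hdK]; norm_num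

/-- ★ **`A19e41 = A(19)^{(41)}`, crux prime `p = 41`** (`(41/19) = −1`: `41` is INERT in `ℚ(√−19)`; `K′ = ℚ(√−31)`, `h = 3`):
for every globally minimal `W` `ℚ`-isogenous to a curve `ℚ`-isomorphic to `cm19.quadraticTwist 41` with `r_an(W) ≠ 0`, the CONCLUSION of
crux 21381 at `(W, 41)`, modulo `hKL`, `hGZ`, `hHP`. [cite: KrizLi2019, Thm. 1.20 (pp. 7–8)] [cite: Cox2013, §2.A Thm. 2.13] -/
theorem cruxConclusion_A19e41 (hKL : thm120_padicLogHeegner_unit_of_bernoulli)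
    (hGZ : ∀ (N : ℕ) [NeZero N] (W : WeierstrassCurve ℚ) (K : Type) [Field K] [NumberField K], gross_zagier N W K)
    (hHP : ∀ (W : WeierstrassCurve ℚ) (K : Type) [Field K] [NumberField K], exists_isHeegnerPoint W K)
    (W W₁ : WeierstrassCurve ℚ) [W.IsElliptic] [W.IsGloballyMinimal] [NeZero (W.conductorNorm ℤ)] [W₁.IsElliptic]
    (hiso : IsIsogenous W W₁) (hW₁ : ∃ C : VariableChange ℚ, C • W₁ = cm19.quadraticTwist ((41 : ℤ) : ℚ))
    (hr : W.analyticRank ≠ 0) :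
    ∃ (K : Type) (_ : Field K) (_ : NumberField K),
      IsImaginaryQuadratic K ∧ 4 < (NumberField.discr K).natAbs ∧
      SatisfiesHeegnerHypothesis (W.conductorNorm ℤ) K ∧
      (W.quadraticTwist (NumberField.discr K : ℚ)).entireLFunction 1 ≠ 0 ∧ ¬ 41 ∣ NumberField.classNumber K := by
  haveI : Fact (Nat.Prime 19) := ⟨by norm_num⟩
  exact cruxConclusion_of_block (q := 19) (by norm_num) hKL hGZ hHP cm19 KrizLiBinders.hasCM_bases.2.2.1
    KrizLiBinders.cmRamified_bases.2.2.1 W W₁ hiso (by norm_num) hW₁ hr (d := -31) (h := 3) (by norm_num) (by norm_num)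
    (by rw [show (-31 : ℤ).natAbs = 31 from rfl]; exact (show Nat.Prime 31 by norm_num).squarefree)
    (by norm_num) (by decide +kernel) (by norm_num)
    (fun K _ _ hK2 hdK => exists_krizLiCharacterBlock_A19e41 W W₁ hiso hW₁ K hK2 hdK)
    (fun K _ _ hK2 hdK => satisfiesHeegnerHypothesis_A19e41 W W₁ hiso hW₁ K hK2 hdK)

end Summit.BirchSwinnertonDyer.BirchSwinnertonDyer.Theorems.KrizLiGrossCorner

end
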